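import Literature.Analysis.InnerProduct.HilbertComplexLaplacianClosedRange
import Literature.Analysis.InnerProduct.HilbertComplexRolledUpFredholm
import Literature.Analysis.InnerProduct.HilbertComplexEigenspaceSupersymmetry
import HarnessLib

/-!
# Brüning–Lesch's Theorem 2.4 (2) ⇔ (4) for a short Hilbert complex: finite cohomology iff each of the three
# Laplacians `T*T`, `TT* + S*S`, `SS*` has a finite-dimensional kernel and closed range (a spectral gap at `0`);
# the analytic Betti numbers `dim Ker Δ_i` equal the geometric ones (Cor 2.5 (2.22), (2.24)–(2.25))

Layer `Literature/Analysis/InnerProduct`, namespace `Literature.Analysis.InnerProduct`; sequel BY NAME of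
`HilbertComplexLaplacianClosedRange.lean` (row g31-#11: `isClosed_range_laplacian_iff`,
`isClosed_range_laplacian_iff_exists_gap`), `ClosedHilbertComplexHodgeTheory.lean` (`isClosed_range_laplacian`,
`orthogonal_range_laplacian_eq_pmapKer`), `HilbertComplexLaplacian.lean` (`pmapKer_laplacian_eq`),
`HilbertComplexFiniteCohomology.lean` (`isClosed_range_of_finiteDimensional_cohomology`,
`isClosed_range_of_finiteDimensional_quotient`, `finiteDimensional_harmonic_of_finiteDimensional_cohomology`,
`finrank_harmonic_eq_finrank_cohomology`), `HilbertComplexHarmonicCohomology.lean`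
(`nonempty_linearEquiv_harmonic_quotient_range`), `HilbertComplexRolledUpFredholm.lean` (row g33-#10:
`nonempty_pmapKer_adjoint_linearEquiv_quotient_range`), `HilbertComplexEigenspaceSupersymmetry.lean` (row g33-#1: the
bridges `laplacian_domain_iff_of_adjointCompSelf` / `laplacian_apply_of_adjointCompSelf` /
`laplacian_domain_iff_of_selfCompAdjoint` / `laplacian_apply_of_selfCompAdjoint`, which present `T*T` and `SS*` as the
Laplacians of the windows `E →0 E →T F` and `F →S G →0 G`) and `ClosedRangeTheoremHilbert.lean`
(`isClosed_range_iff_isClosed_range_adjoint`, Kato IV Thm 5.13). Lane `lit-hodgefound` (Track 2 foundations library),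
prover seat `lit-hodgefound-p06` (generation 34), self-proposed row g34-#1. THEOREMS ONLY (no definition, no instance,
no named fact). Unbounded operators are Mathlib's `LinearPMap` (`T : E →ₗ.[𝕜] F`, adjoint `T†`); the kernel of `T` as a
subspace of the source is `(LinearMap.ker T.toFun).map T.domain.subtype` (`mem_pmapKer_iff`). The three Laplacians are
not definitions: `A = T*T` on `E` is any operator with `hdomA`/`hvalA`, `□ = L = TT* + S*S` on `F` any operator with
`hdom`/`hval`, `C = SS*` on `G` any operator with `hdomC`/`hvalC` (they exist: `exists_adjointCompSelf`,
`exists_laplacian`, `exists_selfCompAdjoint`). "`0 ∉ spec_e Δ`" is not defined either: for the self-adjoint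
non-negative `Δ_i` it is written out as "`Ker Δ_i` is finite-dimensional and `Im Δ_i` is closed" (equivalently, §5,
"`Ker Δ_i` is finite-dimensional and `‖u‖ ≤ c‖Δ_i u‖` on `D(Δ_i) ∩ (Ker Δ_i)^⊥`"), and since `(Im Δ_i)^⊥ = Ker Δ_i`
(§1–§3) this is the same as "`Δ_i` is a Fredholm operator".

## Source, verbatim

J. Brüning, M. Lesch, *Hilbert complexes*, J. Funct. Anal. 108 (1992), §2 pp. 90–96 (held text
`paper:doi-10-1016-0022-1236-92-90147-b`, p0003, p0005–p0009):

"if the spaces `H_i := ker D_i / im D_{i−1}` (2.3) are all finite dimensional and if `ℛ_i` is closed for all `i`,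
then we call the complex a Fredholm complex. … we put `p_i := dim H_i` (2.4a) … and, in the Fredholm case,
`ind(𝒟, D) := ∑_{i=0}^N (−1)^i p_i` (2.4b), and we call these quantities the geometric Betti numbers and the
geometric index of the complex … Yet another family of self-adjoint operators is of interest: we write
`Δ = ⊕_{i≥0} D_{i−1}D*_{i−1} ⊕ ⊕_{i≥0} D_i*D_i` (2.14b) … LEMMA 2.2. We have `𝓗̂_i = ker Δ ∩ H_i = ker Δ¹ ∩ ker Δ² ∩ H_i`
… Proof. This is obvious in view of (2.12) and `ker Δ¹ ∩ H_i = ker D*_{i−1}`, `ker Δ² ∩ H_i = ker D_i`. …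
THEOREM 2.4. Let `(𝒟, D)` be a Hilbert complex. The following conditions are equivalent. (1) `(𝒟, D)` is a
Fredholm complex. (2) `dim H_i < ∞` for all `i`. (3) `D` is a Fredholm operator. (4) Denoting by `spec_e` the
essential spectrum, we have `0 ∉ spec_e Δ`. … (2) ⇒ (3). If `H_i` has finite dimension for all `i` then `ℛ_{i−1}`
is closed in `ker D_i` hence closed in `H_i`. Thus we obtain from (2.9) and the closed range theorem
`H_i = 𝓗̂_i ⊕ ℛ_{i−1} ⊕ ℛ*_i` (2.17). Since `ker D_i = 𝓗̂_i ⊕ ℛ_{i−1}` we conclude `𝓗̂_i ≅ H_i` (2.18) …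
(3) ⇔ (4). This is a well known fact. …
COROLLARY 2.5. If `(𝒟, D)` is Fredholm then we have the decomposition `H_i = 𝓗̂_i ⊕ ℛ_{i−1} ⊕ ℛ*_i`. Moreover,
`𝓗̂_i ≅ H_i` and for the geometric index we have `ind(𝒟, D) = ∑_{i≥0} (−1)^i dim 𝓗̂_i` (2.22). Note that (2.17)
holds whenever `ℛ_i` is closed for all `i ≥ 0`. … In case that all `𝓗̂_i` have finite dimension we call `(𝒟, D)` a
weak Fredholm complex. The numbers `β̂_i := dim 𝓗̂_i` (2.24) are called the analytic Betti numbers of `(𝒟, D)` …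
In the weak Fredholm case, we define the analytic index of `(𝒟, D)` as
`înd(𝒟, D) := ∑_{i≥0} (−1)^i β̂_i = dim ker D − dim ker D*` (2.25)."

Here the complex is the short complex `0 → E →T F →S G → 0` (`T`, `S` closed densely defined, `ST = 0` in the
sense `Im T ⊆ Ker S`), its cohomology is `H⁰ = Ker T`, `H¹ = Ker S / Im T`, `H² = G / Im S`, and its Laplacians
(2.14b) are `Δ₀ = T*T` on `E`, `Δ₁ = □ = TT* + S*S` on `F`, `Δ₂ = SS*` on `G`, with `ker Δ₀ = Ker T`,
`ker Δ₁ = 𝔥 = Ker S ∩ Ker T*`, `ker Δ₂ = Ker S*` (Lemma 2.2). For a self-adjoint `Δ_i ≥ 0`, `0 ∉ spec_e Δ_i`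
says that `0` is at most an isolated eigenvalue of finite multiplicity, i.e. `dim ker Δ_i < ∞` and `Δ_i` is
bounded below on `(ker Δ_i)^⊥`, i.e. (closed range theorem, `HilbertComplexLaplacianClosedRange.lean` §2)
`dim ker Δ_i < ∞` and `im Δ_i` is closed — the form in which (4) is written below.

## What is proved (all over `𝕜 = ℝ` or `ℂ`)

* §1 degree `0`, `A = T*T`: **`pmapKer_adjointCompSelf_eq`** (`Ker T*T = Ker T`, Lemma 2.2),
  `orthogonal_range_adjointCompSelf_eq_pmapKer` (`(Im T*T)^⊥ = Ker T*T`), **`isClosed_range_adjointCompSelf_iff`**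
  (`Im T*T` closed ⇔ `Im T` closed), `isClosed_range_adjointCompSelf_iff_exists_gap`,
  **`adjointCompSelf_fredholm_iff`** (`T*T` Fredholm ⇔ `dim Ker T < ∞ ∧ Im T` closed).
* §2 degree `2`, `C = SS*`: **`pmapKer_selfCompAdjoint_eq`** (`Ker SS* = Ker S*`),
  `orthogonal_range_selfCompAdjoint_eq_pmapKer`, **`isClosed_range_selfCompAdjoint_iff`** (`Im SS*` closed ⇔ `Im S`
  closed), `isClosed_range_selfCompAdjoint_iff_isClosed_range_adjoint` (⇔ `Im S*` closed),
  `isClosed_range_selfCompAdjoint_iff_exists_gap`, **`selfCompAdjoint_fredholm_iff`**,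
  `finrank_pmapKer_selfCompAdjoint_eq_finrank_quotient_range` (`dim Ker SS* = dim G ⧸ Im S` for `Im S` closed).
* §3 degree `1`, `□ = TT* + S*S`: **`laplacian_fredholm_iff`** (`□` Fredholm ⇔ `dim 𝔥 < ∞ ∧ Im T, Im S` closed).
* §4 **Theorem 2.4 (2) ⇔ (4)**: `laplacians_fredholm_of_finiteDimensional_cohomology` ((2) ⇒ (4)),
  `finiteDimensional_cohomology_of_laplacians_fredholm` ((4) ⇒ (2), using only the three kernels and `Im □`),
  **`finiteDimensional_cohomology_iff_laplacians_fredholm`**.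
* §5 the gap form: **`finiteDimensional_cohomology_iff_laplacians_gap`** — finite cohomology ⇔ for each `Δ_i`:
  `dim Ker Δ_i < ∞` and `‖u‖ ≤ c_i‖Δ_i u‖` on `D(Δ_i) ∩ (Ker Δ_i)^⊥`.
* §6 Cor 2.5 (2.22) with (2.24)–(2.25): `finrank_pmapKer_adjointCompSelf_eq` (`β̂₀ = p₀`),
  `finrank_pmapKer_laplacian_eq_finrank_cohomology` (`β̂₁ = p₁`),
  `finrank_pmapKer_selfCompAdjoint_eq_finrank_cohomology` (`β̂₂ = p₂`) and
  **`analyticIndex_eq_geometricIndex`** (`∑ (−1)^i dim Ker Δ_i = ∑ (−1)^i dim H_i`) for a Fredholm complex.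

## References

* [BruningLesch1992] J. Brüning, M. Lesch, *Hilbert complexes*, J. Funct. Anal. 108 (1992) 88–132, §2 (2.3)–(2.4),
  (2.14b), Lemma 2.2, Thm 2.4, Cor 2.5 (2.22), (2.24)–(2.25).
* [Kato1966] T. Kato, *Perturbation Theory for Linear Operators* (1966), IV §5.2 Thm 5.13 (closed range theorem) and
  V §3.7 Thm 3.24 (`T*T`), through `ClosedRangeTheoremHilbert.lean` / `AdjointCompSelfAdjoint.lean`.
* [Hormander1965] L. Hörmander, *L² estimates and existence theorems for the ∂̄ operator*, Acta Math. 113 (1965),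
  Thms 1.1.1–1.1.2 (closed range ⇔ the estimate), through `HilbertComplexLaplacianClosedRange.lean`.
* [Bei2014] F. Bei, arXiv:1401.2766, §1 Prop 1.2 (`H^i ≅ 𝓗^i`), through `HilbertComplexFiniteCohomology.lean`.
* [Gilkey1995] P. B. Gilkey, *Invariance theory, the heat equation, and the Atiyah–Singer index theorem* (1995), §1.5
  p. 45 (`N(Δ^e) = N(P)`, `N(Δ^o) = N(P*)`).
-/

noncomputable section

open scoped InnerProductSpace LinearPMap

namespace Literature.Analysis.InnerProduct

variable {𝕜 E F G : Type*} [RCLike 𝕜]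
variable [NormedAddCommGroup E] [InnerProductSpace 𝕜 E] [CompleteSpace E]
variable [NormedAddCommGroup F] [InnerProductSpace 𝕜 F] [CompleteSpace F]
variable [NormedAddCommGroup G] [InnerProductSpace 𝕜 G] [CompleteSpace G]

/-! ### §0 The zero operator (the missing ends `𝔈⁻¹ = 𝔈ᵈ⁺¹ = 0` of the short complex): plumbing -/

section Zero

variable {D : Type*} [NormedAddCommGroup D] [InnerProductSpace 𝕜 D] [CompleteSpace D]

omit [CompleteSpace E] [CompleteSpace D] in
/-- The zero operator is densely (indeed everywhere) defined. [folklore] -/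
private theorem dense_zero_pmap_domain' : Dense (((0 : D →ₗ.[𝕜] E).domain : Submodule 𝕜 D) : Set D) := by
  rw [LinearPMap.zero_domain, Submodule.top_coe]; exact dense_univ

omit [CompleteSpace E] [CompleteSpace D] in
/-- The zero operator (domain everything) is closed: its graph is `D × {0}`. [folklore] -/
private theorem zero_pmap_isClosed' : (0 : D →ₗ.[𝕜] E).IsClosed := by
  have hset : ((0 : D →ₗ.[𝕜] E).graph : Set (D × E)) = Set.univ ×ˢ {0} := by
    ext p
    rw [SetLike.mem_coe, LinearPMap.mem_graph_iff, Set.mem_prod]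
    constructor
    · rintro ⟨y, -, hy⟩
      rw [LinearPMap.zero_apply] at hy
      exact ⟨Set.mem_univ _, Set.mem_singleton_iff.2 hy.symm⟩
    · rintro ⟨-, hp⟩
      exact ⟨⟨p.1, Submodule.mem_top⟩, rfl, by rw [LinearPMap.zero_apply]; exact (Set.mem_singleton_iff.1 hp).symm⟩
  unfold LinearPMap.IsClosed
  rw [hset]
  exact isClosed_univ.prod isClosed_singleton

omit [CompleteSpace E] [CompleteSpace D] in
/-- `Im 0 ⊆ X`. [folklore] -/
private theorem range_zero_pmap_le' (X : Submodule 𝕜 E) : LinearMap.range (0 : D →ₗ.[𝕜] E).toFun ≤ X := by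
  rintro _ ⟨x, rfl⟩
  have h : (0 : D →ₗ.[𝕜] E).toFun x = 0 := LinearPMap.zero_apply x
  rw [h]; exact X.zero_mem

omit [CompleteSpace E] [CompleteSpace D] in
/-- `Im 0 = 0` is closed. [folklore] -/
private theorem isClosed_range_zero_pmap' :
    IsClosed ((LinearMap.range (0 : D →ₗ.[𝕜] E).toFun : Submodule 𝕜 E) : Set E) := by
  rw [le_bot_iff.1 (range_zero_pmap_le' (D := D) (⊥ : Submodule 𝕜 E)), Submodule.bot_coe]
  exact isClosed_singleton

omit [CompleteSpace E] [CompleteSpace D] in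
/-- `X ⊆ Ker 0` (everything). [folklore] -/
private theorem le_pmapKer_zero' (X : Submodule 𝕜 D) :
    X ≤ (LinearMap.ker (0 : D →ₗ.[𝕜] E).toFun).map (0 : D →ₗ.[𝕜] E).domain.subtype := fun x _ ↦
  mem_pmapKer_iff.2 ⟨(Submodule.mem_top : x ∈ (⊤ : Submodule 𝕜 D)), LinearPMap.zero_apply _⟩

omit [CompleteSpace E] [CompleteSpace D] in
/-- `Ker 0 =` everything. [folklore] -/
private theorem pmapKer_zero_eq_top' :
    (LinearMap.ker (0 : D →ₗ.[𝕜] E).toFun).map (0 : D →ₗ.[𝕜] E).domain.subtype = ⊤ :=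
  eq_top_iff.2 (le_pmapKer_zero' ⊤)

omit [CompleteSpace E] in
/-- `Ker 0* =` everything (`0* = 0` on `D(0*) = E`). [folklore] -/
private theorem pmapKer_adjoint_zero_eq_top' :
    (LinearMap.ker (0 : D →ₗ.[𝕜] E)†.toFun).map (0 : D →ₗ.[𝕜] E)†.domain.subtype = ⊤ := by
  refine eq_top_iff.2 fun y _ ↦ ?_
  have key : ∀ x : (0 : D →ₗ.[𝕜] E).domain, ⟪(0 : D), (x : D)⟫_𝕜 = ⟪y, (0 : D →ₗ.[𝕜] E) x⟫_𝕜 := fun x ↦ by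
    have h : ((0 : D →ₗ.[𝕜] E) x : E) = 0 := LinearPMap.zero_apply x
    rw [h, inner_zero_left, inner_zero_right]
  have hy : y ∈ (0 : D →ₗ.[𝕜] E)†.domain := LinearPMap.mem_adjoint_domain_of_exists _ ⟨0, key⟩
  exact mem_pmapKer_iff.2 ⟨hy, LinearPMap.adjoint_apply_eq dense_zero_pmap_domain' ⟨y, hy⟩ key⟩

end Zero

variable {T : E →ₗ.[𝕜] F} {S : F →ₗ.[𝕜] G} {A : E →ₗ.[𝕜] E} {L : F →ₗ.[𝕜] F} {C : G →ₗ.[𝕜] G}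

/-! ### §1 Degree `0`: the Laplacian `Δ₀ = T*T` — `Ker T*T = Ker T`, `Im T*T` closed ⇔ `Im T` closed -/

omit [CompleteSpace F] [CompleteSpace G] in
/-- **`Ker T*T = Ker T`** as subspaces of `E` ("`ker Δ² ∩ H_i = ker D_i`", Lemma 2.2; the membership form is
`mem_pmapKer_iff_adjointCompSelf_apply_eq_zero` of row g33-#12). [cite: BruningLesch1992, §2 Lemma 2.2; Gilkey1995,
§1.5 p. 45 ("`N(Δ^e) = N(P)`")] -/
theorem pmapKer_adjointCompSelf_eq (hdT : Dense (T.domain : Set E))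
    (hdomA : ∀ x : E, x ∈ A.domain ↔ ∃ hx : x ∈ T.domain, T ⟨x, hx⟩ ∈ T†.domain)
    (hvalA : ∀ (x : A.domain) (hx : (x : E) ∈ T.domain) (hTx : T ⟨x, hx⟩ ∈ T†.domain),
      A x = T† ⟨T ⟨x, hx⟩, hTx⟩) :
    (LinearMap.ker A.toFun).map A.domain.subtype = (LinearMap.ker T.toFun).map T.domain.subtype := by
  rw [pmapKer_laplacian_eq (T := (0 : E →ₗ.[𝕜] E)) (S := T) dense_zero_pmap_domain' hdT
    (laplacian_domain_iff_of_adjointCompSelf hdomA) (laplacian_apply_of_adjointCompSelf hvalA),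
    pmapKer_adjoint_zero_eq_top', inf_top_eq]

omit [CompleteSpace G] in
/-- **`(Im T*T)^⊥ = Ker T*T`** (`T*T` is self-adjoint, `Ker = (Im)^⊥` of the adjoint). [cite: BruningLesch1992, §2
(2.14a)–(2.14b) ("three self-adjoint nonnegative operators"); Kato1966, V §3.7 Thm 3.24] -/
theorem orthogonal_range_adjointCompSelf_eq_pmapKer (hdT : Dense (T.domain : Set E)) (hcT : T.IsClosed)
    (hdomA : ∀ x : E, x ∈ A.domain ↔ ∃ hx : x ∈ T.domain, T ⟨x, hx⟩ ∈ T†.domain)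
    (hvalA : ∀ (x : A.domain) (hx : (x : E) ∈ T.domain) (hTx : T ⟨x, hx⟩ ∈ T†.domain),
      A x = T† ⟨T ⟨x, hx⟩, hTx⟩) :
    (LinearMap.range A.toFun)ᗮ = (LinearMap.ker A.toFun).map A.domain.subtype :=
  orthogonal_range_laplacian_eq_pmapKer (T := (0 : E →ₗ.[𝕜] E)) (S := T) dense_zero_pmap_domain'
    zero_pmap_isClosed' hdT hcT (range_zero_pmap_le' _) (laplacian_domain_iff_of_adjointCompSelf hdomA)
    (laplacian_apply_of_adjointCompSelf hvalA)

omit [CompleteSpace G] in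
/-- **`Im T*T` is closed iff `Im T` is closed** (both are equivalent to the estimate `‖u‖ ≤ c‖Tu‖` on
`D(T) ∩ (Ker T)^⊥`; here from `isClosed_range_laplacian_iff` for the window `E →0 E →T F`). [cite: BruningLesch1992,
§2 Thm 2.4 ((3) ⇔ (4) "a well known fact", with (2.14a) `Δ_ev = D*D`); Kato1966, IV §5.2 Thm 5.13] -/
theorem isClosed_range_adjointCompSelf_iff (hdT : Dense (T.domain : Set E)) (hcT : T.IsClosed)
    (hdomA : ∀ x : E, x ∈ A.domain ↔ ∃ hx : x ∈ T.domain, T ⟨x, hx⟩ ∈ T†.domain)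
    (hvalA : ∀ (x : A.domain) (hx : (x : E) ∈ T.domain) (hTx : T ⟨x, hx⟩ ∈ T†.domain),
      A x = T† ⟨T ⟨x, hx⟩, hTx⟩) :
    IsClosed ((LinearMap.range A.toFun : Submodule 𝕜 E) : Set E) ↔
      IsClosed ((LinearMap.range T.toFun : Submodule 𝕜 F) : Set F) := by
  rw [isClosed_range_laplacian_iff (T := (0 : E →ₗ.[𝕜] E)) (S := T) dense_zero_pmap_domain' zero_pmap_isClosed'
    hdT hcT (range_zero_pmap_le' _) (laplacian_domain_iff_of_adjointCompSelf hdomA)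
    (laplacian_apply_of_adjointCompSelf hvalA)]
  exact ⟨fun h ↦ h.2, fun h ↦ ⟨isClosed_range_zero_pmap', h⟩⟩

omit [CompleteSpace G] in
/-- **`Im T*T` is closed iff `T*T` has a spectral gap at `0`**: `‖u‖ ≤ c‖T*Tu‖` for `u ∈ D(T*T)`, `u ⊥ Ker T`.
[cite: BruningLesch1992, §2 Thm 2.4 (4) ("`0 ∉ spec_e Δ`"); Hormander1965, Thms 1.1.1–1.1.2] -/
theorem isClosed_range_adjointCompSelf_iff_exists_gap (hdT : Dense (T.domain : Set E)) (hcT : T.IsClosed)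
    (hdomA : ∀ x : E, x ∈ A.domain ↔ ∃ hx : x ∈ T.domain, T ⟨x, hx⟩ ∈ T†.domain)
    (hvalA : ∀ (x : A.domain) (hx : (x : E) ∈ T.domain) (hTx : T ⟨x, hx⟩ ∈ T†.domain),
      A x = T† ⟨T ⟨x, hx⟩, hTx⟩) :
    IsClosed ((LinearMap.range A.toFun : Submodule 𝕜 E) : Set E) ↔
      ∃ c : ℝ, 0 ≤ c ∧ ∀ u : A.domain, (u : E) ∈ ((LinearMap.ker T.toFun).map T.domain.subtype)ᗮ →
        ‖(u : E)‖ ≤ c * ‖A u‖ := by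
  have h := isClosed_range_laplacian_iff_exists_gap (T := (0 : E →ₗ.[𝕜] E)) (S := T) dense_zero_pmap_domain'
    zero_pmap_isClosed' hdT hcT (range_zero_pmap_le' _) (laplacian_domain_iff_of_adjointCompSelf hdomA)
    (laplacian_apply_of_adjointCompSelf hvalA)
  rw [pmapKer_adjoint_zero_eq_top', inf_top_eq] at h
  exact h

omit [CompleteSpace G] in
/-- **`Δ₀ = T*T` is Fredholm iff `dim Ker T < ∞` and `Im T` is closed** ("Fredholm" written out: finite-dimensional
kernel, closed range, finite-dimensional `(Im)^⊥`; the last clause is the first since `(Im T*T)^⊥ = Ker T*T = Ker T`).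
[cite: BruningLesch1992, §2 Thm 2.4 ((2) ⇔ (3) ⇔ (4)), Lemma 2.2] -/
theorem adjointCompSelf_fredholm_iff (hdT : Dense (T.domain : Set E)) (hcT : T.IsClosed)
    (hdomA : ∀ x : E, x ∈ A.domain ↔ ∃ hx : x ∈ T.domain, T ⟨x, hx⟩ ∈ T†.domain)
    (hvalA : ∀ (x : A.domain) (hx : (x : E) ∈ T.domain) (hTx : T ⟨x, hx⟩ ∈ T†.domain),
      A x = T† ⟨T ⟨x, hx⟩, hTx⟩) :
    (FiniteDimensional 𝕜 ((LinearMap.ker A.toFun).map A.domain.subtype) ∧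
        IsClosed ((LinearMap.range A.toFun : Submodule 𝕜 E) : Set E) ∧
          FiniteDimensional 𝕜 (LinearMap.range A.toFun)ᗮ) ↔
      (FiniteDimensional 𝕜 ((LinearMap.ker T.toFun).map T.domain.subtype) ∧
        IsClosed ((LinearMap.range T.toFun : Submodule 𝕜 F) : Set F)) := by
  rw [orthogonal_range_adjointCompSelf_eq_pmapKer hdT hcT hdomA hvalA, pmapKer_adjointCompSelf_eq hdT hdomA hvalA,
    isClosed_range_adjointCompSelf_iff hdT hcT hdomA hvalA]
  exact ⟨fun h ↦ ⟨h.1, h.2.1⟩, fun h ↦ ⟨h.1, h.2, h.1⟩⟩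

/-! ### §2 Degree `2`: the Laplacian `Δ₂ = SS*` — `Ker SS* = Ker S*`, `Im SS*` closed ⇔ `Im S` closed -/

omit [CompleteSpace E] in
/-- **`Ker SS* = Ker S*`** as subspaces of `G` ("`ker Δ¹ ∩ H_i = ker D*_{i−1}`", Lemma 2.2; membership form
`mem_pmapKer_adjoint_iff_selfCompAdjoint_apply_eq_zero`, row g33-#12). [cite: BruningLesch1992, §2 Lemma 2.2; Gilkey1995,
§1.5 p. 45 ("`N(Δ^o) = N(P*)`")] -/
theorem pmapKer_selfCompAdjoint_eq (hdS : Dense (S.domain : Set F))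
    (hdomC : ∀ y : G, y ∈ C.domain ↔ ∃ hy : y ∈ S†.domain, S† ⟨y, hy⟩ ∈ S.domain)
    (hvalC : ∀ (y : C.domain) (hy : (y : G) ∈ S†.domain) (hSy : S† ⟨y, hy⟩ ∈ S.domain),
      C y = S ⟨S† ⟨y, hy⟩, hSy⟩) :
    (LinearMap.ker C.toFun).map C.domain.subtype = (LinearMap.ker S†.toFun).map S†.domain.subtype := by
  rw [pmapKer_laplacian_eq (T := S) (S := (0 : G →ₗ.[𝕜] G)) hdS dense_zero_pmap_domain'
    (laplacian_domain_iff_of_selfCompAdjoint hdomC) (laplacian_apply_of_selfCompAdjoint hvalC),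
    pmapKer_zero_eq_top', top_inf_eq]

omit [CompleteSpace E] in
/-- **`(Im SS*)^⊥ = Ker SS*`** (`SS*` is self-adjoint). [cite: BruningLesch1992, §2 (2.14a)–(2.14b); Kato1966, V §3.7
Thm 3.24] -/
theorem orthogonal_range_selfCompAdjoint_eq_pmapKer (hdS : Dense (S.domain : Set F)) (hcS : S.IsClosed)
    (hdomC : ∀ y : G, y ∈ C.domain ↔ ∃ hy : y ∈ S†.domain, S† ⟨y, hy⟩ ∈ S.domain)
    (hvalC : ∀ (y : C.domain) (hy : (y : G) ∈ S†.domain) (hSy : S† ⟨y, hy⟩ ∈ S.domain),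
      C y = S ⟨S† ⟨y, hy⟩, hSy⟩) :
    (LinearMap.range C.toFun)ᗮ = (LinearMap.ker C.toFun).map C.domain.subtype :=
  orthogonal_range_laplacian_eq_pmapKer (T := S) (S := (0 : G →ₗ.[𝕜] G)) hdS hcS dense_zero_pmap_domain'
    zero_pmap_isClosed' (le_pmapKer_zero' _) (laplacian_domain_iff_of_selfCompAdjoint hdomC)
    (laplacian_apply_of_selfCompAdjoint hvalC)

omit [CompleteSpace E] in
/-- **`Im SS*` is closed iff `Im S` is closed** (from `isClosed_range_laplacian_iff` for the window `F →S G →0 G`).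
[cite: BruningLesch1992, §2 Thm 2.4 ((3) ⇔ (4), with (2.14a) `Δ_odd = DD*`); Kato1966, IV §5.2 Thm 5.13] -/
theorem isClosed_range_selfCompAdjoint_iff (hdS : Dense (S.domain : Set F)) (hcS : S.IsClosed)
    (hdomC : ∀ y : G, y ∈ C.domain ↔ ∃ hy : y ∈ S†.domain, S† ⟨y, hy⟩ ∈ S.domain)
    (hvalC : ∀ (y : C.domain) (hy : (y : G) ∈ S†.domain) (hSy : S† ⟨y, hy⟩ ∈ S.domain),
      C y = S ⟨S† ⟨y, hy⟩, hSy⟩) :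
    IsClosed ((LinearMap.range C.toFun : Submodule 𝕜 G) : Set G) ↔
      IsClosed ((LinearMap.range S.toFun : Submodule 𝕜 G) : Set G) := by
  rw [isClosed_range_laplacian_iff (T := S) (S := (0 : G →ₗ.[𝕜] G)) hdS hcS dense_zero_pmap_domain'
    zero_pmap_isClosed' (le_pmapKer_zero' _) (laplacian_domain_iff_of_selfCompAdjoint hdomC)
    (laplacian_apply_of_selfCompAdjoint hvalC)]
  exact ⟨fun h ↦ h.1, fun h ↦ ⟨h, isClosed_range_zero_pmap'⟩⟩

omit [CompleteSpace E] in
/-- … **iff `Im S*` is closed** (closed range theorem). [cite: BruningLesch1992, §2 Thm 2.4 (proof (3) ⇒ (1): "`ℛ_i`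
and `ℛ*_i` are closed"); Kato1966, IV §5.2 Thm 5.13] -/
theorem isClosed_range_selfCompAdjoint_iff_isClosed_range_adjoint (hdS : Dense (S.domain : Set F))
    (hcS : S.IsClosed)
    (hdomC : ∀ y : G, y ∈ C.domain ↔ ∃ hy : y ∈ S†.domain, S† ⟨y, hy⟩ ∈ S.domain)
    (hvalC : ∀ (y : C.domain) (hy : (y : G) ∈ S†.domain) (hSy : S† ⟨y, hy⟩ ∈ S.domain),
      C y = S ⟨S† ⟨y, hy⟩, hSy⟩) :
    IsClosed ((LinearMap.range C.toFun : Submodule 𝕜 G) : Set G) ↔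
      IsClosed ((LinearMap.range S†.toFun : Submodule 𝕜 F) : Set F) := by
  rw [isClosed_range_selfCompAdjoint_iff hdS hcS hdomC hvalC, isClosed_range_iff_isClosed_range_adjoint hdS hcS]

omit [CompleteSpace E] in
/-- **`Im SS*` is closed iff `SS*` has a spectral gap at `0`**: `‖y‖ ≤ c‖SS*y‖` for `y ∈ D(SS*)`, `y ⊥ Ker S*`.
[cite: BruningLesch1992, §2 Thm 2.4 (4); Hormander1965, Thms 1.1.1–1.1.2] -/
theorem isClosed_range_selfCompAdjoint_iff_exists_gap (hdS : Dense (S.domain : Set F)) (hcS : S.IsClosed)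
    (hdomC : ∀ y : G, y ∈ C.domain ↔ ∃ hy : y ∈ S†.domain, S† ⟨y, hy⟩ ∈ S.domain)
    (hvalC : ∀ (y : C.domain) (hy : (y : G) ∈ S†.domain) (hSy : S† ⟨y, hy⟩ ∈ S.domain),
      C y = S ⟨S† ⟨y, hy⟩, hSy⟩) :
    IsClosed ((LinearMap.range C.toFun : Submodule 𝕜 G) : Set G) ↔
      ∃ c : ℝ, 0 ≤ c ∧ ∀ u : C.domain, (u : G) ∈ ((LinearMap.ker S†.toFun).map S†.domain.subtype)ᗮ →
        ‖(u : G)‖ ≤ c * ‖C u‖ := by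
  have h := isClosed_range_laplacian_iff_exists_gap (T := S) (S := (0 : G →ₗ.[𝕜] G)) hdS hcS dense_zero_pmap_domain'
    zero_pmap_isClosed' (le_pmapKer_zero' _) (laplacian_domain_iff_of_selfCompAdjoint hdomC)
    (laplacian_apply_of_selfCompAdjoint hvalC)
  rw [pmapKer_zero_eq_top', top_inf_eq] at h
  exact h

omit [CompleteSpace E] in
/-- **`Δ₂ = SS*` is Fredholm iff `dim Ker S* < ∞` and `Im S` is closed.** [cite: BruningLesch1992, §2 Thm 2.4
((2) ⇔ (3) ⇔ (4)), Lemma 2.2, (2.21)] -/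
theorem selfCompAdjoint_fredholm_iff (hdS : Dense (S.domain : Set F)) (hcS : S.IsClosed)
    (hdomC : ∀ y : G, y ∈ C.domain ↔ ∃ hy : y ∈ S†.domain, S† ⟨y, hy⟩ ∈ S.domain)
    (hvalC : ∀ (y : C.domain) (hy : (y : G) ∈ S†.domain) (hSy : S† ⟨y, hy⟩ ∈ S.domain),
      C y = S ⟨S† ⟨y, hy⟩, hSy⟩) :
    (FiniteDimensional 𝕜 ((LinearMap.ker C.toFun).map C.domain.subtype) ∧
        IsClosed ((LinearMap.range C.toFun : Submodule 𝕜 G) : Set G) ∧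
          FiniteDimensional 𝕜 (LinearMap.range C.toFun)ᗮ) ↔
      (FiniteDimensional 𝕜 ((LinearMap.ker S†.toFun).map S†.domain.subtype) ∧
        IsClosed ((LinearMap.range S.toFun : Submodule 𝕜 G) : Set G)) := by
  rw [orthogonal_range_selfCompAdjoint_eq_pmapKer hdS hcS hdomC hvalC, pmapKer_selfCompAdjoint_eq hdS hdomC hvalC,
    isClosed_range_selfCompAdjoint_iff hdS hcS hdomC hvalC]
  exact ⟨fun h ↦ ⟨h.1, h.2.1⟩, fun h ↦ ⟨h.1, h.2, h.1⟩⟩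

omit [CompleteSpace E] in
/-- **`dim Ker SS* = dim (G ⧸ Im S)`** when `Im S` is closed (`Ker SS* = Ker S* = (Im S)^⊥ ≅ G ⧸ Im S`: the
analytic Betti number `β̂₂` is the geometric one, (2.18)). [cite: BruningLesch1992, §2 Cor 2.5 ("`𝓗̂_i ≅ H_i`"),
(2.24)] -/
theorem finrank_pmapKer_selfCompAdjoint_eq_finrank_quotient_range (hdS : Dense (S.domain : Set F))
    (hdomC : ∀ y : G, y ∈ C.domain ↔ ∃ hy : y ∈ S†.domain, S† ⟨y, hy⟩ ∈ S.domain)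
    (hvalC : ∀ (y : C.domain) (hy : (y : G) ∈ S†.domain) (hSy : S† ⟨y, hy⟩ ∈ S.domain),
      C y = S ⟨S† ⟨y, hy⟩, hSy⟩)
    (hRS : IsClosed ((LinearMap.range S.toFun : Submodule 𝕜 G) : Set G)) :
    Module.finrank 𝕜 ((LinearMap.ker C.toFun).map C.domain.subtype) =
      Module.finrank 𝕜 (G ⧸ LinearMap.range S.toFun) := by
  rw [pmapKer_selfCompAdjoint_eq hdS hdomC hvalC]
  obtain ⟨e⟩ := nonempty_pmapKer_adjoint_linearEquiv_quotient_range hdS hRS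
  exact e.finrank_eq

/-! ### §3 Degree `1`: `□ = TT* + S*S` is Fredholm iff `dim 𝔥 < ∞` and `Im T`, `Im S` are closed -/

/-- **`Δ₁ = □` is Fredholm iff `𝔥 = Ker S ∩ Ker T*` is finite-dimensional and `Im T`, `Im S` are closed**
(`Ker □ = 𝔥`, `(Im □)^⊥ = Ker □`, `Im □` closed ⇔ `Im T`, `Im S` closed). [cite: BruningLesch1992, §2 Thm 2.4
((2) ⇔ (3) ⇔ (4)), Lemma 2.2, (2.20)] -/
theorem laplacian_fredholm_iff (hdT : Dense (T.domain : Set E)) (hcT : T.IsClosed)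
    (hdS : Dense (S.domain : Set F)) (hcS : S.IsClosed)
    (hST : LinearMap.range T.toFun ≤ (LinearMap.ker S.toFun).map S.domain.subtype)
    (hdom : ∀ x : F, x ∈ L.domain ↔ (∃ hxT : x ∈ T†.domain, T† ⟨x, hxT⟩ ∈ T.domain) ∧
      (∃ hxS : x ∈ S.domain, S ⟨x, hxS⟩ ∈ S†.domain))
    (hval : ∀ (x : L.domain) (hxT : (x : F) ∈ T†.domain) (hTx : T† ⟨x, hxT⟩ ∈ T.domain)
      (hxS : (x : F) ∈ S.domain) (hSx : S ⟨x, hxS⟩ ∈ S†.domain),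
      L x = T ⟨T† ⟨x, hxT⟩, hTx⟩ + S† ⟨S ⟨x, hxS⟩, hSx⟩) :
    (FiniteDimensional 𝕜 ((LinearMap.ker L.toFun).map L.domain.subtype) ∧
        IsClosed ((LinearMap.range L.toFun : Submodule 𝕜 F) : Set F) ∧
          FiniteDimensional 𝕜 (LinearMap.range L.toFun)ᗮ) ↔
      (FiniteDimensional 𝕜 ↥((LinearMap.ker S.toFun).map S.domain.subtype ⊓
          (LinearMap.ker T†.toFun).map T†.domain.subtype) ∧
        IsClosed ((LinearMap.range T.toFun : Submodule 𝕜 F) : Set F) ∧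
          IsClosed ((LinearMap.range S.toFun : Submodule 𝕜 G) : Set G)) := by
  rw [orthogonal_range_laplacian_eq_pmapKer hdT hcT hdS hcS hST hdom hval, pmapKer_laplacian_eq hdT hdS hdom hval,
    isClosed_range_laplacian_iff hdT hcT hdS hcS hST hdom hval]
  exact ⟨fun h ↦ ⟨h.1, h.2.1⟩, fun h ↦ ⟨h.1, h.2, h.1⟩⟩

/-! ### §4 Brüning–Lesch Theorem 2.4 (2) ⇔ (4): finite cohomology iff the three Laplacians are Fredholm -/

/-- **Theorem 2.4 (2) ⇒ (4) for a short complex**: if `Ker T`, `Ker S / Im T` and `G / Im S` are finite-dimensional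
then each of `T*T`, `□ = TT* + S*S`, `SS*` has a finite-dimensional kernel and closed range (`Im T`, `Im S` are closed
by (2.17); `Ker T*T = Ker T`, `Ker □ = 𝔥 ≅ Ker S / Im T`, `Ker SS* = Ker S* ≅ G / Im S` by Lemma 2.2 and (2.18)).
[cite: BruningLesch1992, §2 Thm 2.4 ((2) ⇒ (3) ⇔ (4)), Cor 2.5 (2.17)–(2.18); Bei2014, §1 Prop 1.2] -/
theorem laplacians_fredholm_of_finiteDimensional_cohomology (hdT : Dense (T.domain : Set E)) (hcT : T.IsClosed)
    (hdS : Dense (S.domain : Set F)) (hcS : S.IsClosed)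
    (hST : LinearMap.range T.toFun ≤ (LinearMap.ker S.toFun).map S.domain.subtype)
    (hdomA : ∀ x : E, x ∈ A.domain ↔ ∃ hx : x ∈ T.domain, T ⟨x, hx⟩ ∈ T†.domain)
    (hvalA : ∀ (x : A.domain) (hx : (x : E) ∈ T.domain) (hTx : T ⟨x, hx⟩ ∈ T†.domain),
      A x = T† ⟨T ⟨x, hx⟩, hTx⟩)
    (hdom : ∀ x : F, x ∈ L.domain ↔ (∃ hxT : x ∈ T†.domain, T† ⟨x, hxT⟩ ∈ T.domain) ∧
      (∃ hxS : x ∈ S.domain, S ⟨x, hxS⟩ ∈ S†.domain))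
    (hval : ∀ (x : L.domain) (hxT : (x : F) ∈ T†.domain) (hTx : T† ⟨x, hxT⟩ ∈ T.domain)
      (hxS : (x : F) ∈ S.domain) (hSx : S ⟨x, hxS⟩ ∈ S†.domain),
      L x = T ⟨T† ⟨x, hxT⟩, hTx⟩ + S† ⟨S ⟨x, hxS⟩, hSx⟩)
    (hdomC : ∀ y : G, y ∈ C.domain ↔ ∃ hy : y ∈ S†.domain, S† ⟨y, hy⟩ ∈ S.domain)
    (hvalC : ∀ (y : C.domain) (hy : (y : G) ∈ S†.domain) (hSy : S† ⟨y, hy⟩ ∈ S.domain),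
      C y = S ⟨S† ⟨y, hy⟩, hSy⟩)
    [FiniteDimensional 𝕜 ((LinearMap.ker T.toFun).map T.domain.subtype)]
    [FiniteDimensional 𝕜 (↥((LinearMap.ker S.toFun).map S.domain.subtype) ⧸
      (LinearMap.range T.toFun).comap ((LinearMap.ker S.toFun).map S.domain.subtype).subtype)]
    [FiniteDimensional 𝕜 (G ⧸ LinearMap.range S.toFun)] :
    (FiniteDimensional 𝕜 ((LinearMap.ker A.toFun).map A.domain.subtype) ∧
        IsClosed ((LinearMap.range A.toFun : Submodule 𝕜 E) : Set E)) ∧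
      (FiniteDimensional 𝕜 ((LinearMap.ker L.toFun).map L.domain.subtype) ∧
        IsClosed ((LinearMap.range L.toFun : Submodule 𝕜 F) : Set F)) ∧
      (FiniteDimensional 𝕜 ((LinearMap.ker C.toFun).map C.domain.subtype) ∧
        IsClosed ((LinearMap.range C.toFun : Submodule 𝕜 G) : Set G)) := by
  have hRT : IsClosed ((LinearMap.range T.toFun : Submodule 𝕜 F) : Set F) :=
    isClosed_range_of_finiteDimensional_cohomology hcT hcS hST
  have hRS : IsClosed ((LinearMap.range S.toFun : Submodule 𝕜 G) : Set G) :=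
    isClosed_range_of_finiteDimensional_quotient hcS
  refine ⟨⟨?_, (isClosed_range_adjointCompSelf_iff hdT hcT hdomA hvalA).2 hRT⟩,
    ⟨?_, isClosed_range_laplacian hdT hcT hdS hcS hST hRT hRS hdom hval⟩,
    ⟨?_, (isClosed_range_selfCompAdjoint_iff hdS hcS hdomC hvalC).2 hRS⟩⟩
  · rw [pmapKer_adjointCompSelf_eq hdT hdomA hvalA]
    infer_instance
  · rw [pmapKer_laplacian_eq hdT hdS hdom hval]
    exact finiteDimensional_harmonic_of_finiteDimensional_cohomology hdT hcT hcS hST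
  · rw [pmapKer_selfCompAdjoint_eq hdS hdomC hvalC]
    obtain ⟨e⟩ := nonempty_pmapKer_adjoint_linearEquiv_quotient_range hdS hRS
    exact e.symm.finiteDimensional

/-- **Theorem 2.4 (4) ⇒ (2) for a short complex**, with the minimal input: if `Ker T*T`, `Ker □`, `Ker SS*` are
finite-dimensional and `Im □` is closed, then the cohomology `Ker T`, `Ker S / Im T`, `G / Im S` is
finite-dimensional (`Im □` closed gives `Im T`, `Im S` closed, then `Ker S / Im T ≅ 𝔥 = Ker □` and
`G / Im S ≅ Ker S* = Ker SS*`). [cite: BruningLesch1992, §2 Thm 2.4 ((4) ⇔ (3) ⇒ (1)), (2.18)–(2.21)] -/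
theorem finiteDimensional_cohomology_of_laplacians_fredholm (hdT : Dense (T.domain : Set E)) (hcT : T.IsClosed)
    (hdS : Dense (S.domain : Set F)) (hcS : S.IsClosed)
    (hST : LinearMap.range T.toFun ≤ (LinearMap.ker S.toFun).map S.domain.subtype)
    (hdomA : ∀ x : E, x ∈ A.domain ↔ ∃ hx : x ∈ T.domain, T ⟨x, hx⟩ ∈ T†.domain)
    (hvalA : ∀ (x : A.domain) (hx : (x : E) ∈ T.domain) (hTx : T ⟨x, hx⟩ ∈ T†.domain),
      A x = T† ⟨T ⟨x, hx⟩, hTx⟩)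
    (hdom : ∀ x : F, x ∈ L.domain ↔ (∃ hxT : x ∈ T†.domain, T† ⟨x, hxT⟩ ∈ T.domain) ∧
      (∃ hxS : x ∈ S.domain, S ⟨x, hxS⟩ ∈ S†.domain))
    (hval : ∀ (x : L.domain) (hxT : (x : F) ∈ T†.domain) (hTx : T† ⟨x, hxT⟩ ∈ T.domain)
      (hxS : (x : F) ∈ S.domain) (hSx : S ⟨x, hxS⟩ ∈ S†.domain),
      L x = T ⟨T† ⟨x, hxT⟩, hTx⟩ + S† ⟨S ⟨x, hxS⟩, hSx⟩)
    (hdomC : ∀ y : G, y ∈ C.domain ↔ ∃ hy : y ∈ S†.domain, S† ⟨y, hy⟩ ∈ S.domain)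
    (hvalC : ∀ (y : C.domain) (hy : (y : G) ∈ S†.domain) (hSy : S† ⟨y, hy⟩ ∈ S.domain),
      C y = S ⟨S† ⟨y, hy⟩, hSy⟩)
    [FiniteDimensional 𝕜 ((LinearMap.ker A.toFun).map A.domain.subtype)]
    [FiniteDimensional 𝕜 ((LinearMap.ker L.toFun).map L.domain.subtype)]
    (hRL : IsClosed ((LinearMap.range L.toFun : Submodule 𝕜 F) : Set F))
    [FiniteDimensional 𝕜 ((LinearMap.ker C.toFun).map C.domain.subtype)] :
    FiniteDimensional 𝕜 ((LinearMap.ker T.toFun).map T.domain.subtype) ∧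
      FiniteDimensional 𝕜 (↥((LinearMap.ker S.toFun).map S.domain.subtype) ⧸
        (LinearMap.range T.toFun).comap ((LinearMap.ker S.toFun).map S.domain.subtype).subtype) ∧
      FiniteDimensional 𝕜 (G ⧸ LinearMap.range S.toFun) := by
  obtain ⟨hRT, hRS⟩ := (isClosed_range_laplacian_iff hdT hcT hdS hcS hST hdom hval).1 hRL
  have h0 : FiniteDimensional 𝕜 ((LinearMap.ker T.toFun).map T.domain.subtype) := by
    rw [← pmapKer_adjointCompSelf_eq hdT hdomA hvalA]
    infer_instance
  haveI hH : FiniteDimensional 𝕜 ↥((LinearMap.ker S.toFun).map S.domain.subtype ⊓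
      (LinearMap.ker T†.toFun).map T†.domain.subtype) := by
    rw [← pmapKer_laplacian_eq hdT hdS hdom hval]
    infer_instance
  haveI h2 : FiniteDimensional 𝕜 ((LinearMap.ker S†.toFun).map S†.domain.subtype) := by
    rw [← pmapKer_selfCompAdjoint_eq hdS hdomC hvalC]
    infer_instance
  obtain ⟨e₁⟩ := nonempty_linearEquiv_harmonic_quotient_range hdT hcS hST hRT
  obtain ⟨e₂⟩ := nonempty_pmapKer_adjoint_linearEquiv_quotient_range hdS hRS
  exact ⟨h0, e₁.finiteDimensional, e₂.finiteDimensional⟩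

/-- **Brüning–Lesch Theorem 2.4, (2) ⇔ (4), for a short Hilbert complex `0 → E →T F →S G → 0`**: the cohomology
`Ker T`, `Ker S / Im T`, `G / Im S` is finite-dimensional iff each of the Laplacians `Δ₀ = T*T`, `Δ₁ = TT* + S*S`,
`Δ₂ = SS*` has a finite-dimensional kernel and closed range ("`0 ∉ spec_e Δ`" for the non-negative self-adjoint
`Δ = ⊕ Δ_i`, written out). [cite: BruningLesch1992, §2 Thm 2.4 ((2) ⇔ (4)), Lemma 2.2, Cor 2.5] -/
theorem finiteDimensional_cohomology_iff_laplacians_fredholm (hdT : Dense (T.domain : Set E)) (hcT : T.IsClosed)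
    (hdS : Dense (S.domain : Set F)) (hcS : S.IsClosed)
    (hST : LinearMap.range T.toFun ≤ (LinearMap.ker S.toFun).map S.domain.subtype)
    (hdomA : ∀ x : E, x ∈ A.domain ↔ ∃ hx : x ∈ T.domain, T ⟨x, hx⟩ ∈ T†.domain)
    (hvalA : ∀ (x : A.domain) (hx : (x : E) ∈ T.domain) (hTx : T ⟨x, hx⟩ ∈ T†.domain),
      A x = T† ⟨T ⟨x, hx⟩, hTx⟩)
    (hdom : ∀ x : F, x ∈ L.domain ↔ (∃ hxT : x ∈ T†.domain, T† ⟨x, hxT⟩ ∈ T.domain) ∧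
      (∃ hxS : x ∈ S.domain, S ⟨x, hxS⟩ ∈ S†.domain))
    (hval : ∀ (x : L.domain) (hxT : (x : F) ∈ T†.domain) (hTx : T† ⟨x, hxT⟩ ∈ T.domain)
      (hxS : (x : F) ∈ S.domain) (hSx : S ⟨x, hxS⟩ ∈ S†.domain),
      L x = T ⟨T† ⟨x, hxT⟩, hTx⟩ + S† ⟨S ⟨x, hxS⟩, hSx⟩)
    (hdomC : ∀ y : G, y ∈ C.domain ↔ ∃ hy : y ∈ S†.domain, S† ⟨y, hy⟩ ∈ S.domain)
    (hvalC : ∀ (y : C.domain) (hy : (y : G) ∈ S†.domain) (hSy : S† ⟨y, hy⟩ ∈ S.domain),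
      C y = S ⟨S† ⟨y, hy⟩, hSy⟩) :
    (FiniteDimensional 𝕜 ((LinearMap.ker T.toFun).map T.domain.subtype) ∧
      FiniteDimensional 𝕜 (↥((LinearMap.ker S.toFun).map S.domain.subtype) ⧸
        (LinearMap.range T.toFun).comap ((LinearMap.ker S.toFun).map S.domain.subtype).subtype) ∧
      FiniteDimensional 𝕜 (G ⧸ LinearMap.range S.toFun)) ↔
    ((FiniteDimensional 𝕜 ((LinearMap.ker A.toFun).map A.domain.subtype) ∧
        IsClosed ((LinearMap.range A.toFun : Submodule 𝕜 E) : Set E)) ∧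
      (FiniteDimensional 𝕜 ((LinearMap.ker L.toFun).map L.domain.subtype) ∧
        IsClosed ((LinearMap.range L.toFun : Submodule 𝕜 F) : Set F)) ∧
      (FiniteDimensional 𝕜 ((LinearMap.ker C.toFun).map C.domain.subtype) ∧
        IsClosed ((LinearMap.range C.toFun : Submodule 𝕜 G) : Set G))) := by
  constructor
  · rintro ⟨h0, h1, h2⟩
    haveI := h0
    haveI := h1
    haveI := h2
    exact laplacians_fredholm_of_finiteDimensional_cohomology hdT hcT hdS hcS hST hdomA hvalA hdom hval hdomC hvalC
  · rintro ⟨⟨hA, -⟩, ⟨hL, hRL⟩, ⟨hC, -⟩⟩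
    haveI := hA
    haveI := hL
    haveI := hC
    exact finiteDimensional_cohomology_of_laplacians_fredholm hdT hcT hdS hcS hST hdomA hvalA hdom hval hdomC hvalC hRL

/-! ### §5 The gap form: `0 ∉ spec_e Δ_i` as "`dim Ker Δ_i < ∞` and `Δ_i` bounded below on `(Ker Δ_i)^⊥`" -/

/-- **Theorem 2.4 (2) ⇔ (4), gap form**: the cohomology of the short complex is finite-dimensional iff each Laplacian
`Δ_i ∈ {T*T, TT* + S*S, SS*}` has a finite-dimensional kernel and a spectral gap at `0`:
`‖u‖ ≤ c_i‖Δ_i u‖` for all `u ∈ D(Δ_i)` with `u ⊥ Ker Δ_i` (for a non-negative self-adjoint operator this says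
that `0` is not in the essential spectrum). [cite: BruningLesch1992, §2 Thm 2.4 ((2) ⇔ (4) "`0 ∉ spec_e Δ`");
Hormander1965, Thms 1.1.1–1.1.2 (closed range ⇔ the lower bound)] -/
theorem finiteDimensional_cohomology_iff_laplacians_gap (hdT : Dense (T.domain : Set E)) (hcT : T.IsClosed)
    (hdS : Dense (S.domain : Set F)) (hcS : S.IsClosed)
    (hST : LinearMap.range T.toFun ≤ (LinearMap.ker S.toFun).map S.domain.subtype)
    (hdomA : ∀ x : E, x ∈ A.domain ↔ ∃ hx : x ∈ T.domain, T ⟨x, hx⟩ ∈ T†.domain)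
    (hvalA : ∀ (x : A.domain) (hx : (x : E) ∈ T.domain) (hTx : T ⟨x, hx⟩ ∈ T†.domain),
      A x = T† ⟨T ⟨x, hx⟩, hTx⟩)
    (hdom : ∀ x : F, x ∈ L.domain ↔ (∃ hxT : x ∈ T†.domain, T† ⟨x, hxT⟩ ∈ T.domain) ∧
      (∃ hxS : x ∈ S.domain, S ⟨x, hxS⟩ ∈ S†.domain))
    (hval : ∀ (x : L.domain) (hxT : (x : F) ∈ T†.domain) (hTx : T† ⟨x, hxT⟩ ∈ T.domain)
      (hxS : (x : F) ∈ S.domain) (hSx : S ⟨x, hxS⟩ ∈ S†.domain),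
      L x = T ⟨T† ⟨x, hxT⟩, hTx⟩ + S† ⟨S ⟨x, hxS⟩, hSx⟩)
    (hdomC : ∀ y : G, y ∈ C.domain ↔ ∃ hy : y ∈ S†.domain, S† ⟨y, hy⟩ ∈ S.domain)
    (hvalC : ∀ (y : C.domain) (hy : (y : G) ∈ S†.domain) (hSy : S† ⟨y, hy⟩ ∈ S.domain),
      C y = S ⟨S† ⟨y, hy⟩, hSy⟩) :
    (FiniteDimensional 𝕜 ((LinearMap.ker T.toFun).map T.domain.subtype) ∧
      FiniteDimensional 𝕜 (↥((LinearMap.ker S.toFun).map S.domain.subtype) ⧸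
        (LinearMap.range T.toFun).comap ((LinearMap.ker S.toFun).map S.domain.subtype).subtype) ∧
      FiniteDimensional 𝕜 (G ⧸ LinearMap.range S.toFun)) ↔
    ((FiniteDimensional 𝕜 ((LinearMap.ker A.toFun).map A.domain.subtype) ∧
        ∃ c : ℝ, 0 ≤ c ∧ ∀ u : A.domain, (u : E) ∈ ((LinearMap.ker A.toFun).map A.domain.subtype)ᗮ →
          ‖(u : E)‖ ≤ c * ‖A u‖) ∧
      (FiniteDimensional 𝕜 ((LinearMap.ker L.toFun).map L.domain.subtype) ∧
        ∃ c : ℝ, 0 ≤ c ∧ ∀ u : L.domain, (u : F) ∈ ((LinearMap.ker L.toFun).map L.domain.subtype)ᗮ →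
          ‖(u : F)‖ ≤ c * ‖L u‖) ∧
      (FiniteDimensional 𝕜 ((LinearMap.ker C.toFun).map C.domain.subtype) ∧
        ∃ c : ℝ, 0 ≤ c ∧ ∀ u : C.domain, (u : G) ∈ ((LinearMap.ker C.toFun).map C.domain.subtype)ᗮ →
          ‖(u : G)‖ ≤ c * ‖C u‖)) := by
  have hA := isClosed_range_adjointCompSelf_iff_exists_gap hdT hcT hdomA hvalA
  have hL := isClosed_range_laplacian_iff_exists_gap hdT hcT hdS hcS hST hdom hval
  have hC := isClosed_range_selfCompAdjoint_iff_exists_gap hdS hcS hdomC hvalC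
  rw [← pmapKer_adjointCompSelf_eq hdT hdomA hvalA] at hA
  rw [← pmapKer_laplacian_eq hdT hdS hdom hval] at hL
  rw [← pmapKer_selfCompAdjoint_eq hdS hdomC hvalC] at hC
  rw [finiteDimensional_cohomology_iff_laplacians_fredholm hdT hcT hdS hcS hST hdomA hvalA hdom hval hdomC hvalC,
    hA, hL, hC]

/-! ### §6 Analytic `=` geometric Betti numbers and indices (Cor 2.5 (2.22), (2.24)–(2.25)) -/

omit [CompleteSpace F] [CompleteSpace G] in
/-- **`β̂₀ = p₀`: `dim Ker T*T = dim Ker T`.** [cite: BruningLesch1992, §2 Lemma 2.2, Cor 2.5 (2.18), (2.24)] -/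
theorem finrank_pmapKer_adjointCompSelf_eq (hdT : Dense (T.domain : Set E))
    (hdomA : ∀ x : E, x ∈ A.domain ↔ ∃ hx : x ∈ T.domain, T ⟨x, hx⟩ ∈ T†.domain)
    (hvalA : ∀ (x : A.domain) (hx : (x : E) ∈ T.domain) (hTx : T ⟨x, hx⟩ ∈ T†.domain),
      A x = T† ⟨T ⟨x, hx⟩, hTx⟩) :
    Module.finrank 𝕜 ((LinearMap.ker A.toFun).map A.domain.subtype) =
      Module.finrank 𝕜 ((LinearMap.ker T.toFun).map T.domain.subtype) := by
  rw [pmapKer_adjointCompSelf_eq hdT hdomA hvalA]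

omit [CompleteSpace G] in
/-- **`β̂₁ = p₁`: `dim Ker □ = dim (Ker S / Im T)`** for finite-dimensional cohomology in degree `1` (`Ker □ = 𝔥 ≅
Ker S / Im T`, (2.18)). [cite: BruningLesch1992, §2 Cor 2.5 ("`𝓗̂_i ≅ H_i`"), (2.24); Bei2014, §1 Prop 1.2] -/
theorem finrank_pmapKer_laplacian_eq_finrank_cohomology (hdT : Dense (T.domain : Set E)) (hcT : T.IsClosed)
    (hdS : Dense (S.domain : Set F)) (hcS : S.IsClosed)
    (hST : LinearMap.range T.toFun ≤ (LinearMap.ker S.toFun).map S.domain.subtype)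
    (hdom : ∀ x : F, x ∈ L.domain ↔ (∃ hxT : x ∈ T†.domain, T† ⟨x, hxT⟩ ∈ T.domain) ∧
      (∃ hxS : x ∈ S.domain, S ⟨x, hxS⟩ ∈ S†.domain))
    (hval : ∀ (x : L.domain) (hxT : (x : F) ∈ T†.domain) (hTx : T† ⟨x, hxT⟩ ∈ T.domain)
      (hxS : (x : F) ∈ S.domain) (hSx : S ⟨x, hxS⟩ ∈ S†.domain),
      L x = T ⟨T† ⟨x, hxT⟩, hTx⟩ + S† ⟨S ⟨x, hxS⟩, hSx⟩)
    [FiniteDimensional 𝕜 (↥((LinearMap.ker S.toFun).map S.domain.subtype) ⧸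
      (LinearMap.range T.toFun).comap ((LinearMap.ker S.toFun).map S.domain.subtype).subtype)] :
    Module.finrank 𝕜 ((LinearMap.ker L.toFun).map L.domain.subtype) =
      Module.finrank 𝕜 (↥((LinearMap.ker S.toFun).map S.domain.subtype) ⧸
        (LinearMap.range T.toFun).comap ((LinearMap.ker S.toFun).map S.domain.subtype).subtype) := by
  rw [pmapKer_laplacian_eq hdT hdS hdom hval]
  exact finrank_harmonic_eq_finrank_cohomology hdT hcT hcS hST

omit [CompleteSpace E] in
/-- **`β̂₂ = p₂`: `dim Ker SS* = dim (G / Im S)`** for finite-dimensional cohomology in degree `2` (`Im S` is then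
closed and `Ker SS* = Ker S* = (Im S)^⊥`). [cite: BruningLesch1992, §2 Cor 2.5 (2.17)–(2.18), (2.21), (2.24)] -/
theorem finrank_pmapKer_selfCompAdjoint_eq_finrank_cohomology (hdS : Dense (S.domain : Set F)) (hcS : S.IsClosed)
    (hdomC : ∀ y : G, y ∈ C.domain ↔ ∃ hy : y ∈ S†.domain, S† ⟨y, hy⟩ ∈ S.domain)
    (hvalC : ∀ (y : C.domain) (hy : (y : G) ∈ S†.domain) (hSy : S† ⟨y, hy⟩ ∈ S.domain),
      C y = S ⟨S† ⟨y, hy⟩, hSy⟩)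
    [FiniteDimensional 𝕜 (G ⧸ LinearMap.range S.toFun)] :
    Module.finrank 𝕜 ((LinearMap.ker C.toFun).map C.domain.subtype) =
      Module.finrank 𝕜 (G ⧸ LinearMap.range S.toFun) :=
  finrank_pmapKer_selfCompAdjoint_eq_finrank_quotient_range hdS hdomC hvalC
    (isClosed_range_of_finiteDimensional_quotient hcS)

/-- **Corollary 2.5 (2.22) with (2.25): the analytic index equals the geometric index** — for a short Fredholm
complex `0 → E →T F →S G → 0`,
`dim Ker T*T − dim Ker (TT* + S*S) + dim Ker SS* = dim Ker T − dim (Ker S / Im T) + dim (G / Im S)`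
("`ind(𝒟, D) = ∑ (−1)^i dim 𝓗̂_i`", "`înd(𝒟, D) := ∑ (−1)^i β̂_i`"). [cite: BruningLesch1992, §2 (2.4b), Cor 2.5 (2.22),
(2.24)–(2.25)] -/
theorem analyticIndex_eq_geometricIndex (hdT : Dense (T.domain : Set E)) (hcT : T.IsClosed)
    (hdS : Dense (S.domain : Set F)) (hcS : S.IsClosed)
    (hST : LinearMap.range T.toFun ≤ (LinearMap.ker S.toFun).map S.domain.subtype)
    (hdomA : ∀ x : E, x ∈ A.domain ↔ ∃ hx : x ∈ T.domain, T ⟨x, hx⟩ ∈ T†.domain)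
    (hvalA : ∀ (x : A.domain) (hx : (x : E) ∈ T.domain) (hTx : T ⟨x, hx⟩ ∈ T†.domain),
      A x = T† ⟨T ⟨x, hx⟩, hTx⟩)
    (hdom : ∀ x : F, x ∈ L.domain ↔ (∃ hxT : x ∈ T†.domain, T† ⟨x, hxT⟩ ∈ T.domain) ∧
      (∃ hxS : x ∈ S.domain, S ⟨x, hxS⟩ ∈ S†.domain))
    (hval : ∀ (x : L.domain) (hxT : (x : F) ∈ T†.domain) (hTx : T† ⟨x, hxT⟩ ∈ T.domain)
      (hxS : (x : F) ∈ S.domain) (hSx : S ⟨x, hxS⟩ ∈ S†.domain),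
      L x = T ⟨T† ⟨x, hxT⟩, hTx⟩ + S† ⟨S ⟨x, hxS⟩, hSx⟩)
    (hdomC : ∀ y : G, y ∈ C.domain ↔ ∃ hy : y ∈ S†.domain, S† ⟨y, hy⟩ ∈ S.domain)
    (hvalC : ∀ (y : C.domain) (hy : (y : G) ∈ S†.domain) (hSy : S† ⟨y, hy⟩ ∈ S.domain),
      C y = S ⟨S† ⟨y, hy⟩, hSy⟩)
    [FiniteDimensional 𝕜 (↥((LinearMap.ker S.toFun).map S.domain.subtype) ⧸
      (LinearMap.range T.toFun).comap ((LinearMap.ker S.toFun).map S.domain.subtype).subtype)]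
    [FiniteDimensional 𝕜 (G ⧸ LinearMap.range S.toFun)] :
    (Module.finrank 𝕜 ((LinearMap.ker A.toFun).map A.domain.subtype) : ℤ) -
        Module.finrank 𝕜 ((LinearMap.ker L.toFun).map L.domain.subtype) +
          Module.finrank 𝕜 ((LinearMap.ker C.toFun).map C.domain.subtype) =
      (Module.finrank 𝕜 ((LinearMap.ker T.toFun).map T.domain.subtype) : ℤ) -
        Module.finrank 𝕜 (↥((LinearMap.ker S.toFun).map S.domain.subtype) ⧸
          (LinearMap.range T.toFun).comap ((LinearMap.ker S.toFun).map S.domain.subtype).subtype) +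
          Module.finrank 𝕜 (G ⧸ LinearMap.range S.toFun) := by
  rw [finrank_pmapKer_adjointCompSelf_eq hdT hdomA hvalA,
    finrank_pmapKer_laplacian_eq_finrank_cohomology hdT hcT hdS hcS hST hdom hval,
    finrank_pmapKer_selfCompAdjoint_eq_finrank_cohomology hdS hcS hdomC hvalC]

end Literature.Analysis.InnerProduct
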